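import Summits.SmoothPoincare4.SmoothPoincare4.Theses.InformationMetricHadamard
import Summits.SmoothPoincare4.SmoothPoincare4.Theorems.InformationMetricHadamardC0AhRecognitionStubFarCollarImmersive
import Summits.SmoothPoincare4.SmoothPoincare4.Theorems.InformationMetricHadamardC0AhRecognitionStubFarCollarIsFar
import Literature.Geometry.Manifold.InverseFunctionTheorem
import Literature.Geometry.Lorentzian.Isometry

/-!
# Stub `stub_farCollarPackage` of line `core-distance-morse` (crux `InformationMetricHadamard.C0AhRecognition`, stmt-SmoothPoincare4-6015)

Collar bookkeeping for an end collar `Ψ : N × (0,1) → W⁵` over a compact nonempty 4-manifold `N`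
which is smooth and injective on `N × (0,1)`, satisfies the closure clause, is immersive far out
(on `N × (0,t₀)`, the conclusion of the landed `Sketch.stub_farCollarImmersive`) and whose deep
points are metrically far (`hfar`, the conclusion of the landed `Sketch.stub_farCollarIsFar`).
With `K_t := (Ψ(N × (0,t)))ᶜ` the far core:

* `FarCollarPackage.isOpen_image_collar_far`, `FarCollarPackage.isOpen_image_far'` — `Ψ` is open
  on `N × (0,t₀)`; far parts `Ψ(N × (0,t))`, `t ≤ t₀`, are open (inverse function theorem,
  `4 + 1 = 5`);
* `FarCollarPackage.closure_image_far'` — `cl Ψ(N × (0,t)) = Ψ(N × (0,t])` for every `t ∈ (0,1)`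
  (compactness of `N × [t',t]` plus `hfar` to exclude limits of ever deeper points);
* `FarCollarPackage.frontier_far_compl'` — `∂K_t = Ψ(N × {t})` for `t ≤ t₀`;
* `FarCollarPackage.interior_far_compl_nonempty` — `(interior K_t).Nonempty` for `t < t₀`;
* `FarCollarPackage.contMDiff_slice`, `FarCollarPackage.injective_slice`,
  `FarCollarPackage.hasMFDerivAt_slice`, `FarCollarPackage.mfderiv_slice_injective` — the slice
  map `y ↦ Ψ(y,s)` is a smooth injective immersion (chain rule with the inclusion `y ↦ (y,s)`,
  whose differential is `v ↦ (v,0)`);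
* `stub_farCollarPackage` — the registered stub, assembling the seven conjuncts at a level
  `s ∈ (0,t₀)`.

The first five lemmas are adapted from the lead's groundwork
`Cruxes/C0AhRecognition/PrepFarCollarPackage.lean` (not importable from `Theorems`).
Everything is proved (kind = proof); no definitions.
-/

noncomputable section

-- the prescribed namespace `Summit.<P>.<Sub>.…` duplicates `SmoothPoincare4` (P = Sub)
set_option linter.dupNamespace false

open scoped Manifold ContDiff Topology ENNReal NNReal
open Set Function

namespace Summit.SmoothPoincare4.SmoothPoincare4.Cruxes.C0AhRecognition.CoreDistanceMorse

open Literature.Topology.FourManifolds (HomotopySphere)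
open Literature.Geometry.Lorentzian (PseudoRiemannianMetric)

namespace FarCollarPackage

variable {N : Type} [TopologicalSpace N] [ChartedSpace (EuclideanSpace ℝ (Fin 4)) N]
  [IsManifold (𝓡 4) ∞ N] {W : Type} [TopologicalSpace W] [ChartedSpace (EuclideanSpace ℝ (Fin 5)) W]
  [IsManifold (𝓡 5) ∞ W] (Ψ : N × ℝ → W)

-- adapted from Cruxes/C0AhRecognition/PrepFarCollarPackage.lean
/-- **The collar map is open where it is immersive**: if `Ψ` is smooth on `N × (0,1)` and has
injective differential on `N × (0,t₀)`, `t₀ ≤ 1`, then `Ψ` maps open subsets of `N × (0,t₀)` to open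
sets (inverse function theorem, `4 + 1 = 5`). [folklore] -/
theorem isOpen_image_collar_far
    (hsm : ContMDiffOn ((𝓡 4).prod 𝓘(ℝ, ℝ)) (𝓡 5) ∞ Ψ (univ ×ˢ Ioo (0 : ℝ) 1))
    {t₀ : ℝ} (ht₀ : t₀ ≤ 1)
    (himm : ∀ (y : N) (l : ℝ), l ∈ Ioo (0 : ℝ) t₀ →
      Injective (mfderiv ((𝓡 4).prod 𝓘(ℝ, ℝ)) (𝓡 5) Ψ (y, l)))
    {V : Set (N × ℝ)} (hV : IsOpen V) (hVΩ : V ⊆ univ ×ˢ Ioo (0 : ℝ) t₀) :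
    IsOpen (Ψ '' V) := by
  have hΩo : IsOpen (univ ×ˢ Ioo (0 : ℝ) t₀ : Set (N × ℝ)) := isOpen_univ.prod isOpen_Ioo
  have hsub : (univ ×ˢ Ioo (0 : ℝ) t₀ : Set (N × ℝ)) ⊆ univ ×ˢ Ioo (0 : ℝ) 1 :=
    prod_mono Subset.rfl (Ioo_subset_Ioo_right ht₀)
  have hsm₀ : ContMDiffOn ((𝓡 4).prod 𝓘(ℝ, ℝ)) (𝓡 5) ∞ Ψ (univ ×ˢ Ioo (0 : ℝ) t₀) := hsm.mono hsub
  have hdim : Module.finrank ℝ (EuclideanSpace ℝ (Fin 4) × ℝ) =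
      Module.finrank ℝ (EuclideanSpace ℝ (Fin 5)) := by
    rw [Module.finrank_prod, finrank_euclideanSpace_fin, finrank_euclideanSpace_fin,
      Module.finrank_self]
  have hloc : IsLocalDiffeomorphOn ((𝓡 4).prod 𝓘(ℝ, ℝ)) (𝓡 5) ∞ Ψ (univ ×ˢ Ioo (0 : ℝ) t₀) := by
    rintro ⟨x, hx⟩
    have hx' : Injective (mfderiv ((𝓡 4).prod 𝓘(ℝ, ℝ)) (𝓡 5) Ψ x) := by
      obtain ⟨y, l⟩ := x
      exact himm y l hx.2
    set L : (EuclideanSpace ℝ (Fin 4) × ℝ) ≃ₗ[ℝ] EuclideanSpace ℝ (Fin 5) :=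
      Literature.Geometry.Lorentzian.mfderivEquivOfInjective (I := 𝓡 5)
        (I' := (𝓡 4).prod 𝓘(ℝ, ℝ)) Ψ x hx' hdim with hL
    refine Literature.Geometry.Manifold.isLocalDiffeomorphAt_of_mfderiv (by simp) hΩo hx hsm₀
      L.toContinuousLinearEquiv ?_
    ext u
    rfl
  rw [isOpen_iff_mem_nhds]
  rintro _ ⟨x, hxV, rfl⟩
  rw [← hloc.isLocalHomeomorphOn.map_nhds_eq (hVΩ hxV)]
  exact Filter.image_mem_map (hV.mem_nhds hxV)

-- adapted from Cruxes/C0AhRecognition/PrepFarCollarPackage.lean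
/-- Far parts `Ψ(N × (0,t))`, `t ≤ t₀`, are open. [folklore] -/
theorem isOpen_image_far'
    (hsm : ContMDiffOn ((𝓡 4).prod 𝓘(ℝ, ℝ)) (𝓡 5) ∞ Ψ (univ ×ˢ Ioo (0 : ℝ) 1))
    {t₀ : ℝ} (ht₀ : t₀ ≤ 1)
    (himm : ∀ (y : N) (l : ℝ), l ∈ Ioo (0 : ℝ) t₀ →
      Injective (mfderiv ((𝓡 4).prod 𝓘(ℝ, ℝ)) (𝓡 5) Ψ (y, l)))
    {t : ℝ} (ht : t ≤ t₀) : IsOpen (Ψ '' (univ ×ˢ Ioo (0 : ℝ) t)) :=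
  isOpen_image_collar_far Ψ hsm ht₀ himm (isOpen_univ.prod isOpen_Ioo)
    (prod_mono Subset.rfl (Ioo_subset_Ioo_right ht))

omit [ChartedSpace (EuclideanSpace ℝ (Fin 4)) N] [IsManifold (𝓡 4) ∞ N] in
-- adapted from Cruxes/C0AhRecognition/PrepFarCollarPackage.lean
/-- **Closure of a far part**, without immersivity: `cl Ψ(N × (0,t)) = Ψ(N × (0,t])` for every
`t ∈ (0,1)`, provided `N` is compact, `Ψ` is continuous and injective on the strip, the closure
clause holds, and deep points are metrically far from any base point (`hfar`, stub C of line
`Sketch`): a limit of points of bounded depth is a collar point of height `≤ t` by compactness of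
`N × [t', t]`; a limit of ever deeper points would be within distance `1` of points at distance `> 1`.
[folklore] -/
theorem closure_image_far' [CompactSpace N] [T2Space W] [RegularSpace W]
    (G : PseudoRiemannianMetric (𝓡 5) ∞ (EuclideanSpace ℝ (Fin 5)) (TangentSpace (𝓡 5) : W → Type _))
    (hG : G.IsRiemannian)
    (hcont : ContinuousOn Ψ (univ ×ˢ Ioo (0 : ℝ) 1))
    (hinj : InjOn Ψ (univ ×ˢ Ioo (0 : ℝ) 1))
    (hcl : ∀ t ∈ Ioo (0 : ℝ) 1,
      closure (Ψ '' (univ ×ˢ Ioo (0 : ℝ) t)) ⊆ Ψ '' (univ ×ˢ Ioo (0 : ℝ) 1))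
    (hfar : ∀ (x₀ : W) (R : NNReal), ∃ t ∈ Ioo (0 : ℝ) 1, ∀ (y : N) (l : ℝ), l ∈ Ioo (0 : ℝ) t →
      (R : ℝ≥0∞) < G.edist hG x₀ (Ψ (y, l)))
    {t : ℝ} (ht : t ∈ Ioo (0 : ℝ) 1) :
    closure (Ψ '' (univ ×ˢ Ioo (0 : ℝ) t)) = Ψ '' (univ ×ˢ Ioc (0 : ℝ) t) := by
  apply Subset.antisymm
  · intro p hp
    obtain ⟨q, hqΩ, rfl⟩ := hcl t ht hp
    by_contra hne
    have hqt : t < q.2 := by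
      by_contra h
      exact hne ⟨q, ⟨mem_univ _, hqΩ.2.1, not_lt.1 h⟩, rfl⟩
    -- deep points are at distance `> 1` from `p = Ψ q`
    obtain ⟨t', ht', hdeep⟩ := hfar (Ψ q) 1
    -- split the far part at height `t'`
    have hsplit : Ψ '' (univ ×ˢ Ioo (0 : ℝ) t) ⊆
        Ψ '' (univ ×ˢ Ioo (0 : ℝ) t') ∪ Ψ '' (univ ×ˢ Icc t' t) := by
      rintro _ ⟨x, hx, rfl⟩
      rcases lt_or_ge x.2 t' with h | h
      · exact Or.inl ⟨x, ⟨mem_univ _, hx.2.1, h⟩, rfl⟩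
      · exact Or.inr ⟨x, ⟨mem_univ _, h, hx.2.2.le⟩, rfl⟩
    have hp' := closure_mono hsplit hp
    rw [closure_union] at hp'
    rcases hp' with h1 | h2
    · -- the distance-`1` ball about `Ψ q` misses the deep part
      have hball : {y : W | G.edist hG (Ψ q) y < 1} ∈ 𝓝 (Ψ q) :=
        PseudoRiemannianMetric.setOf_edist_lt_mem_nhds hG (Ψ q) one_pos
      rw [mem_closure_iff_nhds] at h1
      obtain ⟨y, hyB, ⟨x, hx, rfl⟩⟩ := h1 _ hball
      have hlt : G.edist hG (Ψ q) (Ψ x) < 1 := hyB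
      have hgt := hdeep x.1 x.2 hx.2
      simp only [ENNReal.coe_one, Prod.mk.eta] at hgt
      exact lt_irrefl _ (hgt.trans hlt)
    · -- a compact piece of bounded depth is closed
      have hKc : IsCompact (Ψ '' (univ ×ˢ Icc t' t)) := by
        refine (isCompact_univ.prod isCompact_Icc).image_of_continuousOn (hcont.mono ?_)
        exact prod_mono Subset.rfl fun l hl ↦ ⟨ht'.1.trans_le hl.1, hl.2.trans_lt ht.2⟩
      rw [hKc.isClosed.closure_eq] at h2
      obtain ⟨x, hx, hxq⟩ := h2
      have hxΩ : x ∈ (univ ×ˢ Ioo (0 : ℝ) 1 : Set (N × ℝ)) :=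
        ⟨mem_univ _, ht'.1.trans_le hx.2.1, hx.2.2.trans_lt ht.2⟩
      have heq : x = q := hinj hxΩ hqΩ hxq
      have : x.2 ≤ t := hx.2.2
      rw [heq] at this
      exact lt_irrefl _ (hqt.trans_le this)
  · rintro _ ⟨x, hx, rfl⟩
    have hxΩ : x ∈ (univ ×ˢ Ioo (0 : ℝ) 1 : Set (N × ℝ)) :=
      ⟨mem_univ _, hx.2.1, lt_of_le_of_lt hx.2.2 ht.2⟩
    have hΩo : IsOpen (univ ×ˢ Ioo (0 : ℝ) 1 : Set (N × ℝ)) := isOpen_univ.prod isOpen_Ioo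
    have hxcl : x ∈ closure (univ ×ˢ Ioo (0 : ℝ) t : Set (N × ℝ)) := by
      rw [closure_prod_eq, closure_univ, closure_Ioo ht.1.ne]
      exact ⟨mem_univ _, hx.2.1.le, hx.2.2⟩
    have hcx : ContinuousWithinAt Ψ (univ ×ˢ Ioo (0 : ℝ) t) x :=
      (hcont.continuousAt (hΩo.mem_nhds hxΩ)).continuousWithinAt
    exact hcx.mem_closure_image hxcl

-- adapted from Cruxes/C0AhRecognition/PrepFarCollarPackage.lean
/-- **The frontier of a far complement is the slice**: `∂K_t = Ψ(N × {t})` for `t ≤ t₀`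
(`K_t = (Ψ(N × (0,t)))ᶜ`), under far immersivity (openness) and the hypotheses of
`closure_image_far'`. [folklore] -/
theorem frontier_far_compl' [CompactSpace N] [T2Space W] [RegularSpace W]
    (G : PseudoRiemannianMetric (𝓡 5) ∞ (EuclideanSpace ℝ (Fin 5)) (TangentSpace (𝓡 5) : W → Type _))
    (hG : G.IsRiemannian)
    (hsm : ContMDiffOn ((𝓡 4).prod 𝓘(ℝ, ℝ)) (𝓡 5) ∞ Ψ (univ ×ˢ Ioo (0 : ℝ) 1))
    (hinj : InjOn Ψ (univ ×ˢ Ioo (0 : ℝ) 1))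
    (hcl : ∀ t ∈ Ioo (0 : ℝ) 1,
      closure (Ψ '' (univ ×ˢ Ioo (0 : ℝ) t)) ⊆ Ψ '' (univ ×ˢ Ioo (0 : ℝ) 1))
    {t₀ : ℝ} (ht₀ : t₀ ≤ 1)
    (himm : ∀ (y : N) (l : ℝ), l ∈ Ioo (0 : ℝ) t₀ →
      Injective (mfderiv ((𝓡 4).prod 𝓘(ℝ, ℝ)) (𝓡 5) Ψ (y, l)))
    (hfar : ∀ (x₀ : W) (R : NNReal), ∃ t ∈ Ioo (0 : ℝ) 1, ∀ (y : N) (l : ℝ), l ∈ Ioo (0 : ℝ) t →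
      (R : ℝ≥0∞) < G.edist hG x₀ (Ψ (y, l)))
    {t : ℝ} (ht : t ∈ Ioo (0 : ℝ) 1) (htt₀ : t ≤ t₀) :
    frontier (Ψ '' (univ ×ˢ Ioo (0 : ℝ) t))ᶜ = Ψ '' (univ ×ˢ {t}) := by
  rw [frontier_compl, frontier, closure_image_far' Ψ G hG hsm.continuousOn hinj hcl hfar ht,
    (isOpen_image_far' Ψ hsm ht₀ himm htt₀).interior_eq]
  ext y
  constructor
  · rintro ⟨⟨x, hx, rfl⟩, hnot⟩
    refine ⟨x, ⟨mem_univ _, ?_⟩, rfl⟩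
    rcases hx.2.2.lt_or_eq with hlt | heq
    · exact absurd ⟨x, ⟨mem_univ _, hx.2.1, hlt⟩, rfl⟩ hnot
    · exact heq
  · rintro ⟨x, hx, rfl⟩
    have hx2 : x.2 = t := hx.2
    refine ⟨⟨x, ⟨mem_univ _, by rw [hx2]; exact ht.1, by rw [hx2]⟩, rfl⟩, ?_⟩
    rintro ⟨x', hx', heq⟩
    have hxΩ : x ∈ (univ ×ˢ Ioo (0 : ℝ) 1 : Set (N × ℝ)) :=
      ⟨mem_univ _, by rw [hx2]; exact ht.1, by rw [hx2]; exact ht.2⟩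
    have := hinj ⟨mem_univ _, hx'.2.1, hx'.2.2.trans ht.2⟩ hxΩ heq
    have h1 : x'.2 < t := hx'.2.2
    rw [this, hx2] at h1
    exact lt_irrefl _ h1

-- adapted from Cruxes/C0AhRecognition/PrepFarCollarPackage.lean
/-- **The far complement has nonempty interior**: for `t < t₀` and `N ≠ ∅`, the open shallow band
`Ψ(N × (t, t₀))` lies in `K_t` (injectivity), hence in its interior. [folklore] -/
theorem interior_far_compl_nonempty [Nonempty N]
    (hsm : ContMDiffOn ((𝓡 4).prod 𝓘(ℝ, ℝ)) (𝓡 5) ∞ Ψ (univ ×ˢ Ioo (0 : ℝ) 1))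
    (hinj : InjOn Ψ (univ ×ˢ Ioo (0 : ℝ) 1))
    {t₀ : ℝ} (ht₀ : t₀ ≤ 1)
    (himm : ∀ (y : N) (l : ℝ), l ∈ Ioo (0 : ℝ) t₀ →
      Injective (mfderiv ((𝓡 4).prod 𝓘(ℝ, ℝ)) (𝓡 5) Ψ (y, l)))
    {t : ℝ} (ht : 0 < t) (htt₀ : t < t₀) :
    (interior (Ψ '' (univ ×ˢ Ioo (0 : ℝ) t))ᶜ).Nonempty := by
  obtain ⟨y⟩ := ‹Nonempty N›
  have hU : IsOpen (Ψ '' (univ ×ˢ Ioo t t₀)) :=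
    isOpen_image_collar_far Ψ hsm ht₀ himm (isOpen_univ.prod isOpen_Ioo)
      (prod_mono Subset.rfl (Ioo_subset_Ioo_left ht.le))
  have hUK : Ψ '' (univ ×ˢ Ioo t t₀) ⊆ (Ψ '' (univ ×ˢ Ioo (0 : ℝ) t))ᶜ := by
    rintro _ ⟨x, hx, rfl⟩ ⟨x', hx', heq⟩
    have h := hinj ⟨mem_univ _, hx'.2.1, hx'.2.2.trans (htt₀.trans_le ht₀)⟩
      ⟨mem_univ _, ht.trans hx.2.1, hx.2.2.trans_le ht₀⟩ heq
    have h1 : x'.2 < t := hx'.2.2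
    have h2 : t < x.2 := hx.2.1
    rw [h] at h1
    exact lt_irrefl _ (h2.trans h1)
  set l : ℝ := (t + t₀) / 2 with hl
  have hl1 : t < l := by rw [hl]; linarith
  have hl2 : l < t₀ := by rw [hl]; linarith
  exact ⟨Ψ (y, l), interior_mono hUK (hU.interior_eq.symm ▸ ⟨(y, l), ⟨mem_univ _, hl1, hl2⟩, rfl⟩)⟩

omit [IsManifold (𝓡 4) ∞ N] [IsManifold (𝓡 5) ∞ W] in
/-- **The slice map is smooth**: `y ↦ Ψ(y, s)` is `C^∞` for every height `s ∈ (0,1)` if `Ψ` is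
`C^∞` on `N × (0,1)` (composition with the smooth inclusion `y ↦ (y, s)`). [folklore] -/
theorem contMDiff_slice
    (hsm : ContMDiffOn ((𝓡 4).prod 𝓘(ℝ, ℝ)) (𝓡 5) ∞ Ψ (univ ×ˢ Ioo (0 : ℝ) 1))
    {s : ℝ} (hs : s ∈ Ioo (0 : ℝ) 1) :
    ContMDiff (𝓡 4) (𝓡 5) ∞ (fun y : N ↦ Ψ (y, s)) := by
  have hι : ContMDiff (𝓡 4) ((𝓡 4).prod 𝓘(ℝ, ℝ)) ∞ (fun y : N ↦ ((y, s) : N × ℝ)) :=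
    contMDiff_id.prodMk contMDiff_const
  exact hsm.comp_contMDiff hι fun y ↦ ⟨mem_univ _, hs⟩

omit [ChartedSpace (EuclideanSpace ℝ (Fin 4)) N] [IsManifold (𝓡 4) ∞ N]
  [ChartedSpace (EuclideanSpace ℝ (Fin 5)) W] [IsManifold (𝓡 5) ∞ W]
  [TopologicalSpace N] [TopologicalSpace W] in
/-- **The slice map is injective**: `y ↦ Ψ(y, s)` is injective for `s ∈ (0,1)` if `Ψ` is
injective on `N × (0,1)`. [folklore] -/
theorem injective_slice (hinj : InjOn Ψ (univ ×ˢ Ioo (0 : ℝ) 1)) {s : ℝ} (hs : s ∈ Ioo (0 : ℝ) 1) :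
    Injective (fun y : N ↦ Ψ (y, s)) := by
  intro y y' h
  have hy : ((y, s) : N × ℝ) ∈ (univ ×ˢ Ioo (0 : ℝ) 1 : Set (N × ℝ)) := ⟨mem_univ _, hs⟩
  have hy' : ((y', s) : N × ℝ) ∈ (univ ×ˢ Ioo (0 : ℝ) 1 : Set (N × ℝ)) := ⟨mem_univ _, hs⟩
  exact (Prod.mk.inj (hinj hy hy' h)).1

omit [IsManifold (𝓡 4) ∞ N] [IsManifold (𝓡 5) ∞ W] in
/-- **Differential of the slice map**: `d(y ↦ Ψ(y,s))_y = dΨ_{(y,s)} ∘ (v ↦ (v, 0))` at heights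
`s ∈ (0,1)` (chain rule with the inclusion `y ↦ (y,s)`, whose differential is `v ↦ (v,0)`).
[folklore] -/
theorem hasMFDerivAt_slice
    (hsm : ContMDiffOn ((𝓡 4).prod 𝓘(ℝ, ℝ)) (𝓡 5) ∞ Ψ (univ ×ˢ Ioo (0 : ℝ) 1))
    {s : ℝ} (hs : s ∈ Ioo (0 : ℝ) 1) (y : N) :
    HasMFDerivAt (𝓡 4) (𝓡 5) (fun y : N ↦ Ψ (y, s)) y
      ((mfderiv ((𝓡 4).prod 𝓘(ℝ, ℝ)) (𝓡 5) Ψ (y, s)).comp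
        ((ContinuousLinearMap.id ℝ (TangentSpace (𝓡 4) y)).prod
          (0 : TangentSpace (𝓡 4) y →L[ℝ] ℝ))) := by
  have hΩo : IsOpen (univ ×ˢ Ioo (0 : ℝ) 1 : Set (N × ℝ)) := isOpen_univ.prod isOpen_Ioo
  have hΨ : MDifferentiableAt ((𝓡 4).prod 𝓘(ℝ, ℝ)) (𝓡 5) Ψ (y, s) :=
    (hsm.contMDiffAt (hΩo.mem_nhds ⟨mem_univ _, hs⟩)).mdifferentiableAt (by simp)
  have hι : HasMFDerivAt (𝓡 4) ((𝓡 4).prod 𝓘(ℝ, ℝ)) (fun y : N ↦ ((y, s) : N × ℝ)) y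
      ((ContinuousLinearMap.id ℝ (TangentSpace (𝓡 4) y)).prod
        (0 : TangentSpace (𝓡 4) y →L[ℝ] ℝ)) :=
    (hasMFDerivAt_id y).prodMk (hasMFDerivAt_const s y)
  exact hΨ.hasMFDerivAt.comp y hι

omit [IsManifold (𝓡 4) ∞ N] [IsManifold (𝓡 5) ∞ W] in
/-- **The slice map is an immersion where the collar is**: if `dΨ_{(y,s)}` is injective then so is
`d(y ↦ Ψ(y,s))_y = dΨ_{(y,s)} ∘ (v ↦ (v,0))`. [folklore] -/
theorem mfderiv_slice_injective
    (hsm : ContMDiffOn ((𝓡 4).prod 𝓘(ℝ, ℝ)) (𝓡 5) ∞ Ψ (univ ×ˢ Ioo (0 : ℝ) 1))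
    {s : ℝ} (hs : s ∈ Ioo (0 : ℝ) 1) (y : N)
    (himm : Injective (mfderiv ((𝓡 4).prod 𝓘(ℝ, ℝ)) (𝓡 5) Ψ (y, s))) :
    Injective (mfderiv (𝓡 4) (𝓡 5) (fun y : N ↦ Ψ (y, s)) y) := by
  rw [(hasMFDerivAt_slice Ψ hsm hs y).mfderiv, ContinuousLinearMap.coe_comp]
  refine himm.comp ?_
  intro v v' h
  -- `(v, 0) = (v', 0)`, read in `T_y N × ℝ` (the tangent space of `N × ℝ` at `(y, s)`)
  have h' : ((ContinuousLinearMap.id ℝ (TangentSpace (𝓡 4) y)).prod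
      (0 : TangentSpace (𝓡 4) y →L[ℝ] ℝ)) v =
      ((ContinuousLinearMap.id ℝ (TangentSpace (𝓡 4) y)).prod
        (0 : TangentSpace (𝓡 4) y →L[ℝ] ℝ)) v' := h
  simpa using h'

end FarCollarPackage

/-- **Stub P (`farCollarPackage`).** Let `Ψ : N × ℝ → W⁵` be smooth and injective on `N × (0,1)`
(`N` a nonempty closed 4-manifold), with the closure clause, immersive on `N × (0,t₀)` and with
metrically far deep points (`hfar`, the conclusion of the landed `Sketch.stub_farCollarIsFar`). Then
for every `s ∈ (0,t₀)`: the far part `Ψ(N × (0,s))` is open, its closure is `Ψ(N × (0,s])`, the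
frontier of the far core `K_s = (Ψ(N × (0,s)))ᶜ` is the slice `{Ψ(y,s)}`, `K_s` has nonempty
interior, and the slice map `y ↦ Ψ(y,s)` is a smooth injective immersion. (Inverse function theorem
`4 + 1 = 5`, compactness of `N × [s',s]`, `hfar` to exclude limits of ever deeper points, and the
chain rule for the slice map.) [folklore] -/
theorem stub_farCollarPackage
    (N : Type) [TopologicalSpace N] [T2Space N] [SecondCountableTopology N] [CompactSpace N]
    [Nonempty N] [ChartedSpace (EuclideanSpace ℝ (Fin 4)) N] [IsManifold (𝓡 4) ∞ N]
    (W : Type) [TopologicalSpace W] [T2Space W] [SecondCountableTopology W]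
    [ChartedSpace (EuclideanSpace ℝ (Fin 5)) W] [IsManifold (𝓡 5) ∞ W]
    (G : PseudoRiemannianMetric (𝓡 5) ∞ (EuclideanSpace ℝ (Fin 5)) (TangentSpace (𝓡 5) : W → Type _))
    (hG : G.IsRiemannian) (Ψ : N × ℝ → W)
    (hsm : ContMDiffOn ((𝓡 4).prod 𝓘(ℝ, ℝ)) (𝓡 5) ∞ Ψ (univ ×ˢ Ioo (0 : ℝ) 1))
    (hinj : InjOn Ψ (univ ×ˢ Ioo (0 : ℝ) 1))
    (hcl : ∀ t ∈ Ioo (0 : ℝ) 1, closure (Ψ '' (univ ×ˢ Ioo (0 : ℝ) t)) ⊆ Ψ '' (univ ×ˢ Ioo (0 : ℝ) 1))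
    (t₀ : ℝ) (ht₀ : t₀ ∈ Ioo (0 : ℝ) 1)
    (himm : ∀ (y : N) (l : ℝ), l ∈ Ioo (0 : ℝ) t₀ →
      Injective (mfderiv ((𝓡 4).prod 𝓘(ℝ, ℝ)) (𝓡 5) Ψ (y, l)))
    (hfar : ∀ (x₀ : W) (R : NNReal), ∃ t ∈ Ioo (0 : ℝ) 1, ∀ (y : N) (l : ℝ), l ∈ Ioo (0 : ℝ) t →
      (R : ℝ≥0∞) < G.edist hG x₀ (Ψ (y, l))) :
    ∀ s ∈ Ioo (0 : ℝ) t₀,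
      IsOpen (Ψ '' (univ ×ˢ Ioo (0 : ℝ) s)) ∧
      closure (Ψ '' (univ ×ˢ Ioo (0 : ℝ) s)) = Ψ '' (univ ×ˢ Ioc (0 : ℝ) s) ∧
      frontier (Ψ '' (univ ×ˢ Ioo (0 : ℝ) s))ᶜ = range (fun y : N ↦ Ψ (y, s)) ∧
      (interior (Ψ '' (univ ×ˢ Ioo (0 : ℝ) s))ᶜ).Nonempty ∧
      ContMDiff (𝓡 4) (𝓡 5) ∞ (fun y : N ↦ Ψ (y, s)) ∧
      Injective (fun y : N ↦ Ψ (y, s)) ∧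
      (∀ y : N, Injective (mfderiv (𝓡 4) (𝓡 5) (fun y : N ↦ Ψ (y, s)) y)) := by
  -- `W` is a finite-dimensional Hausdorff manifold, hence locally compact and regular
  haveI : LocallyCompactSpace W := ChartedSpace.locallyCompactSpace (EuclideanSpace ℝ (Fin 5)) W
  intro s hs
  have hs1 : s ∈ Ioo (0 : ℝ) 1 := ⟨hs.1, hs.2.trans ht₀.2⟩
  refine ⟨?_, ?_, ?_, ?_, ?_, ?_, ?_⟩
  · -- (1) the far part is open (inverse function theorem on `N × (0,t₀)`)
    exact FarCollarPackage.isOpen_image_far' Ψ hsm ht₀.2.le himm hs.2.le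
  · -- (2) its closure is `Ψ(N × (0,s])`
    exact FarCollarPackage.closure_image_far' Ψ G hG hsm.continuousOn hinj hcl hfar hs1
  · -- (3) the frontier of the far core is the slice
    rw [FarCollarPackage.frontier_far_compl' Ψ G hG hsm hinj hcl ht₀.2.le himm hfar hs1 hs.2.le]
    ext x
    constructor
    · rintro ⟨p, hp, rfl⟩
      obtain ⟨y, l⟩ := p
      have hl : l = s := hp.2
      subst hl
      exact ⟨y, rfl⟩
    · rintro ⟨y, rfl⟩
      exact ⟨(y, s), ⟨mem_univ _, rfl⟩, rfl⟩
  · -- (4) the far core has nonempty interior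
    exact FarCollarPackage.interior_far_compl_nonempty Ψ hsm hinj ht₀.2.le himm hs.1 hs.2
  · -- (5) the slice map is smooth
    exact FarCollarPackage.contMDiff_slice Ψ hsm hs1
  · -- (6) the slice map is injective
    exact FarCollarPackage.injective_slice Ψ hinj hs1
  · -- (7) the slice map is an immersion
    intro y
    exact FarCollarPackage.mfderiv_slice_injective Ψ hsm hs1 y (himm y s hs)

end Summit.SmoothPoincare4.SmoothPoincare4.Cruxes.C0AhRecognition.CoreDistanceMorse

end
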